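import Mathlib.MeasureTheory.Function.L2Space
import Mathlib.Analysis.InnerProductSpace.ProdL2
import Mathlib.Analysis.Distribution.TestFunction
import Mathlib.Analysis.Calculus.Gradient.Basic
import Literature.Analysis.FluidPDE.PineauVicolWeightedIdentity
import HarnessLib

/-!
# The Gaussian-weighted graph space `H¹(γ)`, `γ = e^{−|y|²/4}` (tools for Pineau–Vicol 2026, Prop. 5.1)

Analysis/FluidPDE support file (definitions with API, all results proved; no named facts) in the
discharge programme of `Literature.Analysis.FluidPDE.pineauVicol2026_rdss_liouville`
(B. Pineau, V. Vicol, arXiv:2607.09619 (2026), Thm. 1.7) and its siblings (Thms. 1.4, 1.9).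
The analytic heart of those theorems is **Proposition 5.1** (p. 12): for a smooth divergence-free
drift `U` with `|U(y)| ≤ C/(1+|y|)` there is a positive `C²` weight `w` in the kernel of
`L* = −Δ − (U + ½y)·∇ − 3/2` with two-sided Gaussian bounds (5.3). The paper builds `w` from
Krein–Rutman principal Dirichlet eigenpairs on balls and Schauder compactness (Lemmas 5.3–5.5),
neither of which is in Mathlib or the tree. The tree's route (see `NOTES` of the provefact unit)
writes `w = γ v` with the Ornstein–Uhlenbeck Gaussian `γ(y) = e^{−|y|²/4}` of Remark 5.2 / (6.7):
`L*(γv) = 0` becomes `−Δv + (½y − U)·∇v + ½(U·y) v = 0`, whose weak form lives on the weighted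
Sobolev space `H¹(γ)`; existence then follows from Lax–Milgram + Rellich + the Fredholm
alternative (the adjoint form kills the constant `1`, so `0` is an eigenvalue), regularity from
hypoellipticity, positivity from a Kato-type argument and Hopf's minimum principle.

This file provides the functional frame, for a finite-dimensional real inner product space `E`
with its Lebesgue measure:

* `gaussWeight y = e^{−|y|²/4}`, its calculus (`∇γ = −½γy`) and integrability;
  `gaussMeasure = γ dy` (a finite measure equivalent to Lebesgue measure), the conversion
  `∫ f dμ_γ = ∫ γ f dy`, and `L²(γ)`-membership of functions of polynomial growth;
* `GaussL2 E = L²(γ)`, `GaussL2Vec E = L²(γ; E)`, `GaussProd E = L²(γ) × L²(γ; E)` (Hilbert, `ℓ²`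
  product); `testPair φ = (φ, ∇φ)` for Mathlib's bundled test functions `φ : 𝓓(E, ℝ)`, linear
  (`testPairₗ`); **`gaussGraph`** = the topological closure `V` of its range — the weighted space
  `H¹(γ)` realised as a closed subspace (hence a Hilbert space, `completeSpace_gaussGraph`);
* inner products and norms as weighted Lebesgue integrals (`inner_gaussL2`, `norm_sq_testPair`, …);
* **the weak-gradient identity on `V`** (`gaussGraph_integral_inner_eq`): for `(f, G) ∈ V` and a
  bounded `C¹` field `Ψ` with bounded divergence, `∫ γ⟪G, Ψ⟫ = −∫ γ f (div Ψ − ½⟪Ψ, y⟫)`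
  (integration by parts on graph pairs, `WholeSpaceIBP`, extended to the closure because both
  sides are continuous linear functionals — `gaussGraph_le`);
* **the weighted Hardy inequality** `∫ |y|²φ²γ ≤ 4d ∫ φ²γ + 16 ∫ |∇φ|²γ`
  (`integral_norm_sq_mul_sq_mul_gaussWeight_le`: integrate `div(φ²γy)`, absorb the cross term) and
  the resulting **uniform Gaussian tails** `∫_{|y|≥R} γφ² ≤ R⁻²(4d+16)‖(φ,∇φ)‖²`
  (`setIntegral_gaussWeight_mul_sq_le_norm_sq`) — the tightness half of the compactness of
  `V ↪ L²(γ)` (the local half is Rellich; next file);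
* **`(1, 0) ∈ V`** (`gaussOnePair_mem_gaussGraph`: the graph pairs of the cut-offs `cutoff (n+1)`
  converge to `(1, 0)`), the element against which the adjoint form vanishes.

## Mathlib / tree search

Mathlib (this pin): `MeasureTheory.Lp` with its `L²` inner product (`MeasureTheory.L2`), `WithLp 2`
products (`WithLp.prod_inner_apply`), bundled test functions `TestFunction` (`𝓓(Ω, F)`),
`Measure.withDensity`, `gradient`; no weighted Sobolev spaces (searched `weighted`, `Sobolev`:
only `TemperedDistribution.MemSobolev`, Bessel potentials). Tree: `Literature.Analysis.FunctionSpaces.MemSobolevDomain`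
(`W^{k,p}(Ω)` for Lebesgue-type measures on open sets; used in the next file through
`rellich_kondrachov_holds`), `WholeSpaceIBP` (`integral_mul_divergence_add_eq_zero_left`,
`cutoff`, `exists_norm_fderiv_cutoff_le`), `PineauVicolWeightedIdentity`
(`integrable_exp_neg_mul_sq_norm'`, `integrable_one_add_norm_pow_mul_exp_neg_mul_sq`).

## References

* B. Pineau, V. Vicol, arXiv:2607.09619 (2026): Prop. 5.1, Remark 5.2 (p. 13: "`L*w = 0` may be
  rewritten as `Δw + ∇·((U + ½y)w) = 0`, the stationary Fokker–Planck equation … When `U ≡ 0`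
  … invariant density … is precisely the Gaussian `μ` from (6.7)"), §6.2 (6.7). [PineauVicol2026]
* L. C. Evans, *Partial Differential Equations*, 2nd ed. (2010), §5.2 (weak derivatives, `W₀` as a
  closure), §6.2 (weak formulations). [Evans2010]
-/

noncomputable section

open MeasureTheory TopologicalSpace Set Function Filter Topology InnerProductSpace Real
open scoped RealInnerProductSpace ENNReal NNReal ContDiff Distributions

namespace Literature.Analysis.FluidPDE

namespace PineauVicol2026

variable {E : Type*} [NormedAddCommGroup E] [InnerProductSpace ℝ E] [FiniteDimensional ℝ E]
  [MeasurableSpace E] [BorelSpace E]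

/-! ### The Gaussian weight `γ(y) = e^{-|y|²/4}` -/

/-- The Ornstein–Uhlenbeck Gaussian weight `γ(y) = e^{−|y|²/4}` (Pineau–Vicol 2026, (6.7): the
invariant density of `dX = −½X dt + √2 dB`, Remark 5.2). [cite: PineauVicol2026, Remark 5.2 and (6.7)] -/
def gaussWeight (y : E) : ℝ := Real.exp (-‖y‖ ^ 2 / 4)

omit [InnerProductSpace ℝ E] [FiniteDimensional ℝ E] [MeasurableSpace E] [BorelSpace E] in
/-- `γ > 0`. [folklore] -/
theorem gaussWeight_pos (y : E) : 0 < gaussWeight y := Real.exp_pos _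

omit [InnerProductSpace ℝ E] [FiniteDimensional ℝ E] [MeasurableSpace E] [BorelSpace E] in
/-- `γ ≤ 1`. [folklore] -/
theorem gaussWeight_le_one (y : E) : gaussWeight y ≤ 1 := by
  unfold gaussWeight
  rw [Real.exp_le_one_iff]
  have : 0 ≤ ‖y‖ ^ 2 / 4 := by positivity
  linarith

omit [FiniteDimensional ℝ E] [MeasurableSpace E] [BorelSpace E] in
/-- `γ` is smooth. [folklore] -/
theorem contDiff_gaussWeight {n : ℕ∞} : ContDiff ℝ n (gaussWeight : E → ℝ) := by
  unfold gaussWeight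
  exact Real.contDiff_exp.comp ((contDiff_norm_sq ℝ).neg.div_const 4)

omit [FiniteDimensional ℝ E] [MeasurableSpace E] [BorelSpace E] in
/-- `γ` is continuous. [folklore] -/
@[fun_prop]
theorem continuous_gaussWeight : Continuous (gaussWeight : E → ℝ) :=
  (contDiff_gaussWeight (n := 0)).continuous

omit [FiniteDimensional ℝ E] in
/-- `γ` is measurable. [folklore] -/
@[fun_prop]
theorem measurable_gaussWeight : Measurable (gaussWeight : E → ℝ) :=
  continuous_gaussWeight.measurable

omit [InnerProductSpace ℝ E] [FiniteDimensional ℝ E] [MeasurableSpace E] [BorelSpace E] in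
/-- `γ(y) = exp(−¼|y|²)`. [folklore] -/
theorem gaussWeight_eq : (gaussWeight : E → ℝ) = fun y => Real.exp (-(1 / 4 : ℝ) * ‖y‖ ^ 2) := by
  funext y
  simp only [gaussWeight]
  congr 1
  ring

omit [FiniteDimensional ℝ E] [MeasurableSpace E] [BorelSpace E] in
/-- `Dγ(y) = γ(y) • D(−|·|²/4)(y)`. [folklore] -/
theorem hasFDerivAt_gaussWeight (y : E) :
    HasFDerivAt (gaussWeight : E → ℝ)
      (Real.exp (-(1 / 4 : ℝ) * ‖y‖ ^ 2) • ((-(1 / 4 : ℝ)) • (2 • (innerSL ℝ y : E →L[ℝ] ℝ)))) y := by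
  rw [gaussWeight_eq]
  exact ((hasStrictFDerivAt_norm_sq y).hasFDerivAt.const_mul (-(1 / 4 : ℝ))).exp

omit [FiniteDimensional ℝ E] [MeasurableSpace E] [BorelSpace E] in
/-- `Dγ(y)[v] = −½ γ(y) ⟪y, v⟫`. [folklore] -/
theorem fderiv_gaussWeight_apply (y v : E) :
    fderiv ℝ gaussWeight y v = -(1 / 2 : ℝ) * gaussWeight y * ⟪y, v⟫ := by
  rw [(hasFDerivAt_gaussWeight y).fderiv, gaussWeight_eq]
  simp only [smul_apply, innerSL_apply_apply, smul_eq_mul]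
  ring

omit [MeasurableSpace E] [BorelSpace E] in
/-- `∇γ(y) = −½ γ(y) y`. [folklore] -/
theorem gradient_gaussWeight (y : E) :
    gradient gaussWeight y = (-(1 / 2 : ℝ) * gaussWeight y) • y := by
  haveI : CompleteSpace E := FiniteDimensional.complete ℝ E
  apply ext_inner_right ℝ
  intro v
  rw [inner_gradient_left, fderiv_gaussWeight_apply, real_inner_smul_left]

/-- `γ` is integrable (Lebesgue measure). [folklore] -/
theorem integrable_gaussWeight : Integrable (gaussWeight : E → ℝ) := by
  have h := integrable_exp_neg_mul_sq_norm' (E := E) (b := 1 / 4) (by norm_num)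
  refine h.congr (Eventually.of_forall fun v => ?_)
  simp only [gaussWeight]
  congr 1
  ring

/-- `‖y‖² γ(y)` is integrable (Lebesgue measure). [folklore] -/
theorem integrable_norm_sq_mul_gaussWeight :
    Integrable (fun y : E => ‖y‖ ^ 2 * gaussWeight y) := by
  have h := integrable_one_add_norm_pow_mul_exp_neg_mul_sq (E := E) (c := 1 / 4) (by norm_num) 2
  refine h.mono' ((continuous_norm.pow 2).mul continuous_gaussWeight).aestronglyMeasurable
    (Eventually.of_forall fun y => ?_)
  rw [Real.norm_of_nonneg (mul_nonneg (sq_nonneg _) (gaussWeight_pos y).le), gaussWeight_eq]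
  have hγ : 0 ≤ rexp (-(1 / 4 : ℝ) * ‖y‖ ^ 2) := (Real.exp_pos _).le
  have : ‖y‖ ^ 2 ≤ (1 + ‖y‖) ^ 2 := by nlinarith [norm_nonneg y]
  exact mul_le_mul_of_nonneg_right this hγ

/-! ### The Gaussian measure `γ dy` and its `L²` spaces -/

/-- The weight as an `ℝ≥0`-valued density. [folklore] -/
def gaussDensity (y : E) : ℝ≥0 := ⟨gaussWeight y, (gaussWeight_pos y).le⟩

omit [InnerProductSpace ℝ E] [FiniteDimensional ℝ E] [MeasurableSpace E] [BorelSpace E] in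
/-- The density coerces to the weight. [folklore] -/
@[simp] theorem coe_gaussDensity (y : E) : (gaussDensity y : ℝ) = gaussWeight y := rfl

omit [FiniteDimensional ℝ E] in
/-- The density is measurable. [folklore] -/
@[fun_prop]
theorem measurable_gaussDensity : Measurable (gaussDensity : E → ℝ≥0) :=
  measurable_gaussWeight.subtype_mk

/-- The Gaussian measure `dμ_γ = γ(y) dy = e^{−|y|²/4} dy` (the space `L²_μ` of Pineau–Vicol 2026,
(6.7), up to normalisation). [cite: PineauVicol2026, (6.7)] -/
def gaussMeasure : Measure E := volume.withDensity fun y => (gaussDensity y : ℝ≥0∞)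

/-- `μ_γ` has finite total mass `∫ γ dy < ∞`. [folklore] -/
theorem gaussMeasure_apply_univ_lt_top : gaussMeasure (E := E) univ < ⊤ := by
  rw [gaussMeasure, withDensity_apply _ MeasurableSet.univ, Measure.restrict_univ]
  have h := (integrable_gaussWeight (E := E)).hasFiniteIntegral
  rw [HasFiniteIntegral] at h
  convert h using 2
  funext y
  rw [enorm_eq_nnnorm, Real.nnnorm_of_nonneg (gaussWeight_pos y).le]
  rfl

/-- `μ_γ` is a finite measure. [folklore] -/
instance isFiniteMeasure_gaussMeasure : IsFiniteMeasure (gaussMeasure (E := E)) :=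
  ⟨gaussMeasure_apply_univ_lt_top⟩

/-- `μ_γ ≪ dy`. [folklore] -/
theorem gaussMeasure_absolutelyContinuous : gaussMeasure (E := E) ≪ volume :=
  withDensity_absolutelyContinuous _ _

/-- `dy ≪ μ_γ` (the density is positive). [folklore] -/
theorem absolutelyContinuous_gaussMeasure : (volume : Measure E) ≪ gaussMeasure := by
  refine withDensity_absolutelyContinuous' measurable_gaussDensity.coe_nnreal_ennreal.aemeasurable
    (Eventually.of_forall fun y => ?_)
  simp only [ne_eq, ENNReal.coe_eq_zero]
  intro h
  exact (gaussWeight_pos y).ne' (by simpa using congrArg ((↑) : ℝ≥0 → ℝ) h)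

/-- `μ_γ`-a.e. and Lebesgue-a.e. agree. [folklore] -/
theorem ae_gaussMeasure_iff {p : E → Prop} :
    (∀ᵐ y ∂(gaussMeasure (E := E)), p y) ↔ ∀ᵐ y ∂(volume : Measure E), p y :=
  ⟨fun h => absolutelyContinuous_gaussMeasure.ae_le h, fun h => gaussMeasure_absolutelyContinuous.ae_le h⟩

/-- `∫ f dμ_γ = ∫ γ f dy`. [folklore] -/
theorem integral_gaussMeasure {F : Type*} [NormedAddCommGroup F] [NormedSpace ℝ F] (f : E → F) :
    ∫ y, f y ∂gaussMeasure = ∫ y, gaussWeight y • f y := by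
  rw [gaussMeasure, integral_withDensity_eq_integral_smul measurable_gaussDensity]
  rfl

/-- `∫ f dμ_γ = ∫ γ f dy` for real `f`. [folklore] -/
theorem integral_gaussMeasure_real (f : E → ℝ) :
    ∫ y, f y ∂gaussMeasure = ∫ y, gaussWeight y * f y :=
  integral_gaussMeasure f

/-- Integrability against `μ_γ` is integrability of `γ f`. [folklore] -/
theorem integrable_gaussMeasure_iff {F : Type*} [NormedAddCommGroup F] [NormedSpace ℝ F]
    {f : E → F} : Integrable f gaussMeasure ↔ Integrable (fun y => gaussWeight y • f y) := by
  rw [gaussMeasure, integrable_withDensity_iff_integrable_coe_smul measurable_gaussDensity]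
  rfl

/-- A bounded a.e.-strongly measurable function is in every `L^p(μ_γ)`. [folklore] -/
theorem memLp_gaussMeasure_of_bound {F : Type*} [NormedAddCommGroup F] {f : E → F} {p : ℝ≥0∞}
    (hf : AEStronglyMeasurable f volume) (C : ℝ) (hC : ∀ y, ‖f y‖ ≤ C) :
    MemLp f p (gaussMeasure (E := E)) :=
  MemLp.of_bound (hf.mono_ac gaussMeasure_absolutelyContinuous) C (Eventually.of_forall hC)

/-- A continuous compactly supported function is in every `L^p(μ_γ)`. [folklore] -/
theorem memLp_gaussMeasure_of_hasCompactSupport {F : Type*} [NormedAddCommGroup F] {f : E → F}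
    {p : ℝ≥0∞} (hf : Continuous f) (hc : HasCompactSupport f) : MemLp f p (gaussMeasure (E := E)) := by
  obtain ⟨C, hC⟩ := hf.bounded_above_of_compact_support hc
  exact memLp_gaussMeasure_of_bound hf.aestronglyMeasurable C hC

/-! ### Gradients of smooth compactly supported functions -/

omit [MeasurableSpace E] [BorelSpace E] in
/-- `∇(f + g) = ∇f + ∇g` for differentiable functions. [folklore] -/
theorem gradient_add' {f g : E → ℝ} (hf : Differentiable ℝ f) (hg : Differentiable ℝ g) :
    gradient (f + g) = gradient f + gradient g := by
  funext x
  simp only [gradient, Pi.add_apply]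
  rw [fderiv_add (hf x) (hg x), map_add]

omit [MeasurableSpace E] [BorelSpace E] in
/-- `∇(c f) = c ∇f` for differentiable functions. [folklore] -/
theorem gradient_const_smul' {f : E → ℝ} (c : ℝ) (hf : Differentiable ℝ f) :
    gradient (c • f) = c • gradient f := by
  funext x
  simp only [gradient, Pi.smul_apply]
  rw [fderiv_const_smul (hf x) c, map_smul]

omit [MeasurableSpace E] [BorelSpace E] in
/-- `|∇f(x)| = ‖Df(x)‖` (Riesz isometry). [folklore] -/
theorem norm_gradient_eq_norm_fderiv (f : E → ℝ) (x : E) : ‖gradient f x‖ = ‖fderiv ℝ f x‖ := by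
  haveI : CompleteSpace E := FiniteDimensional.complete ℝ E
  simp [gradient]

omit [MeasurableSpace E] [BorelSpace E] in
/-- The gradient of a compactly supported function is compactly supported. [folklore] -/
theorem hasCompactSupport_gradient {f : E → ℝ} (hc : HasCompactSupport f) :
    HasCompactSupport (gradient f) := by
  haveI : CompleteSpace E := FiniteDimensional.complete ℝ E
  have h := (hc.fderiv (𝕜 := ℝ)).comp_left (g := fun L : E →L[ℝ] ℝ => (toDual ℝ E).symm L)
    (map_zero _)
  exact h

/-! ### The graph space: closure of `{(φ, ∇φ)}` in `L²(γ) × L²(γ; E)` -/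

variable (E) in
/-- Scalar `L²(γ dy)`. [folklore] -/
abbrev GaussL2 : Type _ := Lp ℝ 2 (gaussMeasure (E := E))

variable (E) in
/-- Vector `L²(γ dy; E)`. [folklore] -/
abbrev GaussL2Vec : Type _ := Lp E 2 (gaussMeasure (E := E))

variable (E) in
/-- The ambient Hilbert space `L²(γ) × L²(γ; E)` with the `ℓ²` product norm. [folklore] -/
abbrev GaussProd : Type _ := WithLp 2 (GaussL2 E × GaussL2Vec E)

/-- A test function lies in `L²(γ)`. [folklore] -/
theorem memLp_testFunction (φ : 𝓓((⊤ : Opens E), ℝ)) :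
    MemLp (φ : E → ℝ) 2 (gaussMeasure (E := E)) :=
  memLp_gaussMeasure_of_hasCompactSupport φ.continuous φ.hasCompactSupport

/-- The gradient of a test function lies in `L²(γ; E)`. [folklore] -/
theorem memLp_gradient_testFunction (φ : 𝓓((⊤ : Opens E), ℝ)) :
    MemLp (gradient (φ : E → ℝ)) 2 (gaussMeasure (E := E)) :=
  memLp_gaussMeasure_of_hasCompactSupport
    (continuous_gradient_of_contDiff (φ.contDiff.of_le (mod_cast le_top)))
    (hasCompactSupport_gradient φ.hasCompactSupport)

/-- The graph pair `(φ, ∇φ) ∈ L²(γ) × L²(γ; E)` of a test function. [folklore] -/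
def testPair (φ : 𝓓((⊤ : Opens E), ℝ)) : GaussProd E :=
  WithLp.toLp 2 ((memLp_testFunction φ).toLp (φ : E → ℝ),
    (memLp_gradient_testFunction φ).toLp (gradient (φ : E → ℝ)))

/-- First component of the graph pair. [folklore] -/
theorem testPair_fst (φ : 𝓓((⊤ : Opens E), ℝ)) :
    (testPair φ).fst = (memLp_testFunction φ).toLp (φ : E → ℝ) := rfl

/-- Second component of the graph pair. [folklore] -/
theorem testPair_snd (φ : 𝓓((⊤ : Opens E), ℝ)) :
    (testPair φ).snd = (memLp_gradient_testFunction φ).toLp (gradient (φ : E → ℝ)) := rfl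

/-- The first component is a.e. `φ`. [folklore] -/
theorem coeFn_testPair_fst (φ : 𝓓((⊤ : Opens E), ℝ)) :
    ((testPair φ).fst : E → ℝ) =ᵐ[gaussMeasure] (φ : E → ℝ) :=
  (memLp_testFunction φ).coeFn_toLp

/-- The second component is a.e. `∇φ`. [folklore] -/
theorem coeFn_testPair_snd (φ : 𝓓((⊤ : Opens E), ℝ)) :
    ((testPair φ).snd : E → E) =ᵐ[gaussMeasure] gradient (φ : E → ℝ) :=
  (memLp_gradient_testFunction φ).coeFn_toLp

/-- Additivity of `φ ↦ (φ, ∇φ)`. [folklore] -/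
theorem testPair_add (φ ψ : 𝓓((⊤ : Opens E), ℝ)) :
    testPair (φ + ψ) = testPair φ + testPair ψ := by
  have hd : ∀ χ : 𝓓((⊤ : Opens E), ℝ), Differentiable ℝ (χ : E → ℝ) := fun χ =>
    χ.contDiff.differentiable (by simp)
  simp only [testPair, ← WithLp.toLp_add, Prod.mk_add_mk]
  congr 1
  refine Prod.ext ?_ ?_
  · change (memLp_testFunction (φ + ψ)).toLp (⇑φ + ⇑ψ) = _
    exact MemLp.toLp_add (memLp_testFunction φ) (memLp_testFunction ψ)
  · change (memLp_gradient_testFunction (φ + ψ)).toLp (gradient (⇑φ + ⇑ψ)) = _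
    rw [← MemLp.toLp_add (memLp_gradient_testFunction φ) (memLp_gradient_testFunction ψ)]
    exact MemLp.toLp_congr (memLp_gradient_testFunction (φ + ψ))
      ((memLp_gradient_testFunction φ).add (memLp_gradient_testFunction ψ))
      (Eventually.of_forall fun x => by rw [FunLike.coe_add, gradient_add' (hd φ) (hd ψ)])

/-- Homogeneity of `φ ↦ (φ, ∇φ)`. [folklore] -/
theorem testPair_smul (c : ℝ) (φ : 𝓓((⊤ : Opens E), ℝ)) :
    testPair (c • φ) = c • testPair φ := by
  have hd : Differentiable ℝ (φ : E → ℝ) := φ.contDiff.differentiable (by simp)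
  simp only [testPair, ← WithLp.toLp_smul, Prod.smul_mk]
  congr 1
  refine Prod.ext ?_ ?_
  · change (memLp_testFunction (c • φ)).toLp (c • ⇑φ) = _
    exact MemLp.toLp_const_smul c (memLp_testFunction φ)
  · change (memLp_gradient_testFunction (c • φ)).toLp (gradient (c • ⇑φ)) = _
    rw [← MemLp.toLp_const_smul c (memLp_gradient_testFunction φ)]
    exact MemLp.toLp_congr (memLp_gradient_testFunction (c • φ))
      ((memLp_gradient_testFunction φ).const_smul c)
      (Eventually.of_forall fun x => by rw [FunLike.coe_smul, gradient_const_smul' c hd])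

/-- `φ ↦ (φ, ∇φ)` as a linear map on test functions. [folklore] -/
def testPairₗ : 𝓓((⊤ : Opens E), ℝ) →ₗ[ℝ] GaussProd E where
  toFun := testPair
  map_add' := testPair_add
  map_smul' := testPair_smul

/-- Unfolding the linear map. [folklore] -/
@[simp] theorem testPairₗ_apply (φ : 𝓓((⊤ : Opens E), ℝ)) : testPairₗ φ = testPair φ := rfl

/-- **The Gaussian graph space `V`**: the closure in `L²(γ) × L²(γ; E)` of the graph
`{(φ, ∇φ) : φ ∈ C_c^∞}` — the weighted Sobolev space `H¹(γ)` realised as a closed subspace of a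
Hilbert space (so that it is a Hilbert space with the graph norm
`‖(f, G)‖² = ∫ f²γ + ∫ |G|²γ`). [folklore] -/
def gaussGraph : Submodule ℝ (GaussProd E) := (LinearMap.range (testPairₗ (E := E))).topologicalClosure

/-- Graph pairs belong to `V`. [folklore] -/
theorem testPair_mem_gaussGraph (φ : 𝓓((⊤ : Opens E), ℝ)) : testPair φ ∈ gaussGraph (E := E) :=
  Submodule.le_topologicalClosure _ ⟨φ, rfl⟩

/-- `V` is closed. [folklore] -/
theorem isClosed_gaussGraph : IsClosed (gaussGraph (E := E) : Set (GaussProd E)) :=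
  Submodule.isClosed_topologicalClosure _

/-- `V` is complete (a Hilbert space). [folklore] -/
instance completeSpace_gaussGraph : CompleteSpace (gaussGraph (E := E)) :=
  isClosed_gaussGraph.completeSpace_coe

/-- `x ∈ V` iff `x` is a limit of graph pairs. [folklore] -/
theorem mem_gaussGraph_iff_seq {x : GaussProd E} :
    x ∈ gaussGraph (E := E) ↔
      ∃ φ : ℕ → 𝓓((⊤ : Opens E), ℝ), Tendsto (fun n => testPair (φ n)) atTop (𝓝 x) := by
  rw [gaussGraph, ← SetLike.mem_coe, Submodule.topologicalClosure_coe, mem_closure_iff_seq_limit]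
  constructor
  · rintro ⟨u, hu, hux⟩
    choose φ hφ using hu
    refine ⟨φ, ?_⟩
    convert hux using 1
    funext n
    exact hφ n
  · rintro ⟨φ, hφ⟩
    exact ⟨fun n => testPair (φ n), fun n => ⟨φ n, rfl⟩, hφ⟩

/-- A closed submodule containing all graph pairs contains `V`. [folklore] -/
theorem gaussGraph_le {K : Submodule ℝ (GaussProd E)} (hK : IsClosed (K : Set (GaussProd E)))
    (h : ∀ φ : 𝓓((⊤ : Opens E), ℝ), testPair φ ∈ K) : gaussGraph (E := E) ≤ K := by
  refine Submodule.topologicalClosure_minimal _ ?_ hK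
  rintro _ ⟨φ, rfl⟩
  exact h φ

/-! ### Inner products and norms as weighted integrals -/

/-- `⟪f, g⟫_{L²(γ)} = ∫ γ f g dy`. [folklore] -/
theorem inner_gaussL2 (f g : GaussL2 E) :
    ⟪f, g⟫ = ∫ y, gaussWeight y * ((f : E → ℝ) y * (g : E → ℝ) y) := by
  rw [L2.inner_def, integral_gaussMeasure_real]
  refine integral_congr_ae (Eventually.of_forall fun y => ?_)
  simp only [RCLike.inner_apply, conj_trivial]
  ring

/-- `‖f‖²_{L²(γ)} = ∫ γ f² dy`. [folklore] -/
theorem norm_sq_gaussL2 (f : GaussL2 E) :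
    ‖f‖ ^ 2 = ∫ y, gaussWeight y * (f : E → ℝ) y ^ 2 := by
  rw [← real_inner_self_eq_norm_sq, inner_gaussL2]
  refine integral_congr_ae (Eventually.of_forall fun y => ?_)
  simp only [sq]

/-- `⟪F, G⟫_{L²(γ;E)} = ∫ γ ⟪F, G⟫ dy`. [folklore] -/
theorem inner_gaussL2Vec (F G : GaussL2Vec E) :
    ⟪F, G⟫ = ∫ y, gaussWeight y * ⟪(F : E → E) y, (G : E → E) y⟫ := by
  rw [L2.inner_def, integral_gaussMeasure_real]

/-- `‖F‖²_{L²(γ;E)} = ∫ γ |F|² dy`. [folklore] -/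
theorem norm_sq_gaussL2Vec (F : GaussL2Vec E) :
    ‖F‖ ^ 2 = ∫ y, gaussWeight y * ‖(F : E → E) y‖ ^ 2 := by
  rw [← real_inner_self_eq_norm_sq, inner_gaussL2Vec]
  refine integral_congr_ae (Eventually.of_forall fun y => ?_)
  dsimp only
  rw [real_inner_self_eq_norm_sq]

/-- The `ℓ²` product norm. [folklore] -/
theorem norm_sq_gaussProd (x : GaussProd E) : ‖x‖ ^ 2 = ‖x.fst‖ ^ 2 + ‖x.snd‖ ^ 2 :=
  WithLp.prod_norm_sq_eq_of_L2 x

/-- `γ f g` is integrable for `f, g ∈ L²(γ)`. [folklore] -/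
theorem integrable_gaussWeight_mul_mul (f g : GaussL2 E) :
    Integrable (fun y => gaussWeight y * ((f : E → ℝ) y * (g : E → ℝ) y)) := by
  have h := L2.integrable_inner (𝕜 := ℝ) f g
  rw [integrable_gaussMeasure_iff] at h
  refine h.congr (Eventually.of_forall fun y => ?_)
  simp only [RCLike.inner_apply, conj_trivial, smul_eq_mul]
  ring

/-- `γ ⟪F, G⟫` is integrable for `F, G ∈ L²(γ; E)`. [folklore] -/
theorem integrable_gaussWeight_mul_inner (F G : GaussL2Vec E) :
    Integrable (fun y => gaussWeight y * ⟪(F : E → E) y, (G : E → E) y⟫) := by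
  have h := L2.integrable_inner (𝕜 := ℝ) F G
  rw [integrable_gaussMeasure_iff] at h
  simpa only [smul_eq_mul] using h

/-- `‖(φ, ∇φ)‖² = ∫ γ φ² + ∫ γ |∇φ|²` (Lebesgue integrals). [folklore] -/
theorem norm_sq_testPair (φ : 𝓓((⊤ : Opens E), ℝ)) :
    ‖testPair φ‖ ^ 2 =
      (∫ y, gaussWeight y * (φ : E → ℝ) y ^ 2) + ∫ y, gaussWeight y * ‖gradient (φ : E → ℝ) y‖ ^ 2 := by
  rw [norm_sq_gaussProd, norm_sq_gaussL2, norm_sq_gaussL2Vec]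
  congr 1
  · refine integral_congr_ae ?_
    have h := ae_gaussMeasure_iff.1 (coeFn_testPair_fst φ)
    filter_upwards [h] with y hy
    rw [hy]
  · refine integral_congr_ae ?_
    have h := ae_gaussMeasure_iff.1 (coeFn_testPair_snd φ)
    filter_upwards [h] with y hy
    rw [hy]

/-! ### Functions of polynomial growth are in `L²(γ)` -/

/-- A strongly measurable `f` with `‖f(y)‖ ≤ C (1 + |y|)ᴺ` lies in `L²(γ)`. [folklore] -/
theorem memLp_gaussMeasure_of_polyGrowth {F : Type*} [NormedAddCommGroup F] {f : E → F}
    (hf : AEStronglyMeasurable f volume) {C : ℝ} {N : ℕ} (hC : ∀ y, ‖f y‖ ≤ C * (1 + ‖y‖) ^ N) :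
    MemLp f 2 (gaussMeasure (E := E)) := by
  have hC0 : 0 ≤ C := by
    have := (norm_nonneg (f 0)).trans (hC 0)
    simpa using this
  rw [memLp_two_iff_integrable_sq_norm (hf.mono_ac gaussMeasure_absolutelyContinuous),
    integrable_gaussMeasure_iff]
  have hg := (integrable_one_add_norm_pow_mul_exp_neg_mul_sq (E := E) (c := 1 / 4) (by norm_num)
    (2 * N)).const_mul (C ^ 2)
  refine hg.mono' (measurable_gaussWeight.aestronglyMeasurable.smul (hf.norm.pow 2))
    (Eventually.of_forall fun y => ?_)
  rw [norm_smul, Real.norm_of_nonneg (gaussWeight_pos y).le, Real.norm_of_nonneg (sq_nonneg _),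
    gaussWeight_eq]
  have h1 : ‖f y‖ ^ 2 ≤ C ^ 2 * (1 + ‖y‖) ^ (2 * N) := by
    calc ‖f y‖ ^ 2 ≤ (C * (1 + ‖y‖) ^ N) ^ 2 := pow_le_pow_left₀ (norm_nonneg _) (hC y) 2
      _ = C ^ 2 * (1 + ‖y‖) ^ (2 * N) := by ring
  have hγ : 0 ≤ rexp (-(1 / 4 : ℝ) * ‖y‖ ^ 2) := (Real.exp_pos _).le
  calc rexp (-(1 / 4) * ‖y‖ ^ 2) * ‖f y‖ ^ 2 ≤ rexp (-(1 / 4) * ‖y‖ ^ 2) * (C ^ 2 * (1 + ‖y‖) ^ (2 * N)) :=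
        mul_le_mul_of_nonneg_left h1 hγ
    _ = C ^ 2 * ((1 + ‖y‖) ^ (2 * N) * rexp (-(1 / 4) * ‖y‖ ^ 2)) := by ring

/-- A bounded strongly measurable function lies in `L²(γ)` (case `N = 0`). [folklore] -/
theorem memLp_gaussMeasure_of_bound' {F : Type*} [NormedAddCommGroup F] {f : E → F}
    (hf : AEStronglyMeasurable f volume) {C : ℝ} (hC : ∀ y, ‖f y‖ ≤ C) :
    MemLp f 2 (gaussMeasure (E := E)) :=
  memLp_gaussMeasure_of_polyGrowth (N := 0) hf (fun y => by simpa using hC y)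

/-! ### The weak-gradient identity on `V` -/

/-- For a test function and a bounded `C¹` field `Ψ` with bounded divergence:
`∫ γ ⟪∇φ, Ψ⟫ = −∫ γ φ (div Ψ − ½⟪Ψ, y⟫)` (integration by parts; `∇γ = −½ γ y`). [folklore] -/
theorem integral_gaussWeight_inner_gradient_eq {φ : E → ℝ} (hφ : ContDiff ℝ 1 φ)
    (hφc : HasCompactSupport φ) {Ψ : E → E} (hΨ : ContDiff ℝ 1 Ψ) :
    ∫ y, gaussWeight y * ⟪gradient φ y, Ψ y⟫ =
      -∫ y, gaussWeight y * (φ y * (VectorCalculus.divergence Ψ y - ⟪Ψ y, y⟫ / 2)) := by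
  have hγΨ : ContDiff ℝ 1 (fun y => gaussWeight y • Ψ y) := (contDiff_gaussWeight.of_le (mod_cast le_top)).smul hΨ
  have h := integral_mul_divergence_add_eq_zero_left hφ hγΨ hφc
  have hdiv : ∀ y, VectorCalculus.divergence (fun y => gaussWeight y • Ψ y) y =
      gaussWeight y * (VectorCalculus.divergence Ψ y - ⟪Ψ y, y⟫ / 2) := by
    intro y
    rw [divergence_smul_apply ((contDiff_gaussWeight (n := 1)).differentiable one_ne_zero y)
      (hΨ.differentiable one_ne_zero y), gradient_gaussWeight, real_inner_smul_right]
    ring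
  have h1 : ∫ y, φ y * VectorCalculus.divergence (fun y => gaussWeight y • Ψ y) y =
      ∫ y, gaussWeight y * (φ y * (VectorCalculus.divergence Ψ y - ⟪Ψ y, y⟫ / 2)) := by
    refine integral_congr_ae (Eventually.of_forall fun y => ?_)
    dsimp only
    rw [hdiv]; ring
  have h2 : ∫ y, ⟪gaussWeight y • Ψ y, gradient φ y⟫ = ∫ y, gaussWeight y * ⟪gradient φ y, Ψ y⟫ := by
    refine integral_congr_ae (Eventually.of_forall fun y => ?_)
    dsimp only
    rw [real_inner_smul_left, real_inner_comm]
  rw [h1, h2] at h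
  linarith

/-- `div Ψ − ½⟪Ψ, y⟫` is in `L²(γ)` for a `C¹` field with `Ψ`, `div Ψ` bounded. [folklore] -/
theorem memLp_divergence_sub_inner {Ψ : E → E} (hΨ : ContDiff ℝ 1 Ψ) {C : ℝ}
    (hb : ∀ y, ‖Ψ y‖ ≤ C) (hdb : ∀ y, |VectorCalculus.divergence Ψ y| ≤ C) :
    MemLp (fun y => VectorCalculus.divergence Ψ y - ⟪Ψ y, y⟫ / 2) 2 (gaussMeasure (E := E)) := by
  have hC0 : 0 ≤ C := (norm_nonneg _).trans (hb 0)
  have hcont : Continuous fun y => VectorCalculus.divergence Ψ y - ⟪Ψ y, y⟫ / 2 :=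
    (continuous_divergence (hΨ.continuous_fderiv one_ne_zero)).sub
      ((hΨ.continuous.inner continuous_id).div_const 2)
  refine memLp_gaussMeasure_of_polyGrowth (C := C) (N := 1) hcont.aestronglyMeasurable fun y => ?_
  rw [Real.norm_eq_abs, pow_one]
  have h1 : |⟪Ψ y, y⟫ / 2| ≤ C * ‖y‖ := by
    rw [abs_div, abs_two]
    have := (abs_real_inner_le_norm (Ψ y) y).trans (mul_le_mul_of_nonneg_right (hb y) (norm_nonneg _))
    have h0 : 0 ≤ C * ‖y‖ := by positivity
    linarith
  calc |VectorCalculus.divergence Ψ y - ⟪Ψ y, y⟫ / 2|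
      ≤ |VectorCalculus.divergence Ψ y| + |⟪Ψ y, y⟫ / 2| := abs_sub _ _
    _ ≤ C + C * ‖y‖ := add_le_add (hdb y) h1
    _ = C * (1 + ‖y‖) := by ring

/-- **Weak-gradient identity on `V`.** For `x = (f, G) ∈ V` and a bounded `C¹` field `Ψ` with
bounded divergence, `∫ γ ⟪G, Ψ⟫ = −∫ γ f (div Ψ − ½⟪Ψ, y⟫)`: `G` is the `γ`-weak gradient of
`f` (both sides are continuous linear functionals of `x` agreeing on graph pairs). [folklore] -/
theorem gaussGraph_integral_inner_eq {x : GaussProd E} (hx : x ∈ gaussGraph (E := E))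
    {Ψ : E → E} (hΨ : ContDiff ℝ 1 Ψ) {C : ℝ} (hb : ∀ y, ‖Ψ y‖ ≤ C)
    (hdb : ∀ y, |VectorCalculus.divergence Ψ y| ≤ C) :
    ∫ y, gaussWeight y * ⟪(x.snd : E → E) y, Ψ y⟫ =
      -∫ y, gaussWeight y * ((x.fst : E → ℝ) y * (VectorCalculus.divergence Ψ y - ⟪Ψ y, y⟫ / 2)) := by
  set m : E → ℝ := fun y => VectorCalculus.divergence Ψ y - ⟪Ψ y, y⟫ / 2 with hm
  have hmL : MemLp m 2 (gaussMeasure (E := E)) := memLp_divergence_sub_inner hΨ hb hdb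
  have hΨL : MemLp Ψ 2 (gaussMeasure (E := E)) :=
    memLp_gaussMeasure_of_bound' hΨ.continuous.aestronglyMeasurable hb
  set gΨ : GaussL2Vec E := hΨL.toLp Ψ
  set gm : GaussL2 E := hmL.toLp m
  -- the continuous linear functional `x ↦ ⟪gΨ, x.2⟫ + ⟪gm, x.1⟫`
  set T : GaussProd E →L[ℝ] ℝ :=
    (innerSL ℝ gΨ).comp (WithLp.sndL 2 ℝ (GaussL2 E) (GaussL2Vec E)) +
      (innerSL ℝ gm).comp (WithLp.fstL 2 ℝ (GaussL2 E) (GaussL2Vec E)) with hT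
  have hTapply : ∀ z : GaussProd E, T z = ⟪gΨ, z.snd⟫ + ⟪gm, z.fst⟫ := fun z => rfl
  -- integrals against representatives
  have hΨae : ∀ᵐ y ∂(volume : Measure E), (gΨ : E → E) y = Ψ y := ae_gaussMeasure_iff.1 hΨL.coeFn_toLp
  have hmae : ∀ᵐ y ∂(volume : Measure E), (gm : E → ℝ) y = m y := ae_gaussMeasure_iff.1 hmL.coeFn_toLp
  have hinner1 : ∀ z : GaussProd E, ⟪gΨ, z.snd⟫ = ∫ y, gaussWeight y * ⟪(z.snd : E → E) y, Ψ y⟫ := by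
    intro z
    rw [inner_gaussL2Vec]
    refine integral_congr_ae ?_
    filter_upwards [hΨae] with y hy
    rw [hy, real_inner_comm]
  have hinner2 : ∀ z : GaussProd E, ⟪gm, z.fst⟫ = ∫ y, gaussWeight y * ((z.fst : E → ℝ) y * m y) := by
    intro z
    rw [inner_gaussL2]
    refine integral_congr_ae ?_
    filter_upwards [hmae] with y hy
    rw [hy, mul_comm ((z.fst : E → ℝ) y)]
  -- `T` vanishes on graph pairs
  have hker : ∀ φ : 𝓓((⊤ : Opens E), ℝ), testPair φ ∈ LinearMap.ker (T : GaussProd E →ₗ[ℝ] ℝ) := by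
    intro φ
    rw [LinearMap.mem_ker, ContinuousLinearMap.coe_coe, hTapply, hinner1, hinner2]
    have hφ1 : ContDiff ℝ 1 (φ : E → ℝ) := φ.contDiff.of_le (mod_cast le_top)
    have e1 : ∫ y, gaussWeight y * ⟪((testPair φ).snd : E → E) y, Ψ y⟫ =
        ∫ y, gaussWeight y * ⟪gradient (φ : E → ℝ) y, Ψ y⟫ := by
      refine integral_congr_ae ?_
      filter_upwards [ae_gaussMeasure_iff.1 (coeFn_testPair_snd φ)] with y hy
      rw [hy]
    have e2 : ∫ y, gaussWeight y * (((testPair φ).fst : E → ℝ) y * m y) =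
        ∫ y, gaussWeight y * ((φ : E → ℝ) y * m y) := by
      refine integral_congr_ae ?_
      filter_upwards [ae_gaussMeasure_iff.1 (coeFn_testPair_fst φ)] with y hy
      rw [hy]
    rw [e1, e2, integral_gaussWeight_inner_gradient_eq hφ1 φ.hasCompactSupport hΨ]
    ring
  have hle : gaussGraph (E := E) ≤ LinearMap.ker (T : GaussProd E →ₗ[ℝ] ℝ) :=
    gaussGraph_le T.isClosed_ker hker
  have h0 : T x = 0 := by simpa using hle hx
  rw [hTapply, hinner1, hinner2] at h0
  linarith

/-! ### The weighted Hardy inequality and Gaussian tails -/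

omit [MeasurableSpace E] [BorelSpace E] in
/-- `∇(φ²) = 2φ ∇φ`. [folklore] -/
theorem gradient_sq {φ : E → ℝ} (hφ : Differentiable ℝ φ) (y : E) :
    gradient (fun z => φ z ^ 2) y = (2 * φ y) • gradient φ y := by
  simp only [gradient]
  rw [((hφ y).hasFDerivAt.pow 2).fderiv, map_smul]
  simp

omit [MeasurableSpace E] [BorelSpace E] in
/-- `div (γ y) = γ (d − ½|y|²)`. [folklore] -/
theorem divergence_gaussWeight_smul_id (y : E) :
    VectorCalculus.divergence (fun z : E => gaussWeight z • z) y =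
      gaussWeight y * (Module.finrank ℝ E - ‖y‖ ^ 2 / 2) := by
  rw [divergence_smul_apply (u := fun z : E => z)
    ((contDiff_gaussWeight (n := 1)).differentiable one_ne_zero y) differentiableAt_id,
    gradient_gaussWeight, real_inner_smul_right, real_inner_self_eq_norm_sq]
  have : VectorCalculus.divergence (fun z : E => z) y = Module.finrank ℝ E := by
    rw [VectorCalculus.divergence, fderiv_fun_id, ContinuousLinearMap.coe_id, LinearMap.trace_id]
  rw [this]
  ring

/-- **Weighted Hardy inequality** for test functions:
`∫ |y|² φ² γ ≤ 4d ∫ φ² γ + 16 ∫ |∇φ|² γ` (integrate `div(φ² γ y) ` over the whole space, using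
`∇γ = −½γy`, and absorb the cross term by Young's inequality). [folklore] -/
theorem integral_norm_sq_mul_sq_mul_gaussWeight_le {φ : E → ℝ} (hφ : ContDiff ℝ ∞ φ)
    (hc : HasCompactSupport φ) :
    ∫ y, ‖y‖ ^ 2 * φ y ^ 2 * gaussWeight y ≤
      4 * Module.finrank ℝ E * (∫ y, gaussWeight y * φ y ^ 2) +
        16 * ∫ y, gaussWeight y * ‖gradient φ y‖ ^ 2 := by
  have hφ1 : ContDiff ℝ 1 φ := hφ.of_le (mod_cast le_top)
  have hφd : Differentiable ℝ φ := hφ1.differentiable one_ne_zero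
  have hθ : ContDiff ℝ 1 (fun z => φ z ^ 2) := hφ1.pow 2
  have hθc : HasCompactSupport (fun z => φ z ^ 2) := hc.comp_left (g := fun t : ℝ => t ^ 2) (by simp)
  have hu : ContDiff ℝ 1 (fun z : E => gaussWeight z • z) :=
    (contDiff_gaussWeight.of_le (mod_cast le_top)).smul contDiff_id
  have hibp := integral_mul_divergence_add_eq_zero_left hθ hu hθc
  have hgc : Continuous (gradient φ) := continuous_gradient_of_contDiff hφ1
  have hgs : HasCompactSupport (fun y => ‖gradient φ y‖ ^ 2) :=
    (hasCompactSupport_gradient hc).comp_left (g := fun v : E => ‖v‖ ^ 2) (by simp)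
  -- the four integrals
  set A : ℝ := ∫ y, gaussWeight y * φ y ^ 2 with hA
  set B : ℝ := ∫ y, gaussWeight y * ‖gradient φ y‖ ^ 2 with hB
  set X : ℝ := ∫ y, ‖y‖ ^ 2 * φ y ^ 2 * gaussWeight y with hX
  set Y : ℝ := ∫ y, gaussWeight y * (φ y * ⟪y, gradient φ y⟫) with hY
  have iA : Integrable (fun y => gaussWeight y * φ y ^ 2) :=
    (continuous_gaussWeight.mul (hφ.continuous.pow 2)).integrable_of_hasCompactSupport hθc.mul_left
  have iX : Integrable (fun y => ‖y‖ ^ 2 * φ y ^ 2 * gaussWeight y) :=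
    (((continuous_norm.pow 2).mul (hφ.continuous.pow 2)).mul continuous_gaussWeight)
      |>.integrable_of_hasCompactSupport (hθc.mul_left.mul_right)
  have iY : Integrable (fun y => gaussWeight y * (φ y * ⟪y, gradient φ y⟫)) :=
    (continuous_gaussWeight.mul (hφ.continuous.mul (continuous_id.inner hgc)))
      |>.integrable_of_hasCompactSupport (hc.mul_right.mul_left)
  have iB : Integrable (fun y => gaussWeight y * ‖gradient φ y‖ ^ 2) :=
    (continuous_gaussWeight.mul ((continuous_norm.comp hgc).pow 2)).integrable_of_hasCompactSupport
      hgs.mul_left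
  -- the identity `d A − X/2 + 2Y = 0`
  have e1 : (fun y => φ y ^ 2 * VectorCalculus.divergence (fun z : E => gaussWeight z • z) y) =
      fun y => (Module.finrank ℝ E : ℝ) * (gaussWeight y * φ y ^ 2) -
        (1 / 2 : ℝ) * (‖y‖ ^ 2 * φ y ^ 2 * gaussWeight y) := by
    funext y; rw [divergence_gaussWeight_smul_id]; ring
  have e2 : (fun y => ⟪gaussWeight y • y, gradient (fun z => φ z ^ 2) y⟫) =
      fun y => (2 : ℝ) * (gaussWeight y * (φ y * ⟪y, gradient φ y⟫)) := by
    funext y; rw [gradient_sq hφd, real_inner_smul_left, real_inner_smul_right]; ring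
  have hid : (Module.finrank ℝ E : ℝ) * A - (1 / 2 : ℝ) * X + 2 * Y = 0 := by
    rw [e1, e2, integral_sub (iA.const_mul _) (iX.const_mul _), integral_const_mul,
      integral_const_mul, integral_const_mul] at hibp
    linarith
  -- Young: `2Y ≤ X/4 + 4B`
  have hyoung : 2 * Y ≤ (1 / 4 : ℝ) * X + 4 * B := by
    have hpt : ∀ y, (2 : ℝ) * (gaussWeight y * (φ y * ⟪y, gradient φ y⟫)) ≤
        (1 / 4 : ℝ) * (‖y‖ ^ 2 * φ y ^ 2 * gaussWeight y) + 4 * (gaussWeight y * ‖gradient φ y‖ ^ 2) := by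
      intro y
      have hγ := (gaussWeight_pos y).le
      have hcs : φ y * ⟪y, gradient φ y⟫ ≤ |φ y| * (‖y‖ * ‖gradient φ y‖) := by
        calc φ y * ⟪y, gradient φ y⟫ ≤ |φ y * ⟪y, gradient φ y⟫| := le_abs_self _
          _ = |φ y| * |⟪y, gradient φ y⟫| := abs_mul _ _
          _ ≤ |φ y| * (‖y‖ * ‖gradient φ y‖) :=
            mul_le_mul_of_nonneg_left (abs_real_inner_le_norm _ _) (abs_nonneg _)
      have hy2 : 2 * (|φ y| * (‖y‖ * ‖gradient φ y‖)) ≤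
          (1 / 4 : ℝ) * (‖y‖ ^ 2 * φ y ^ 2) + 4 * ‖gradient φ y‖ ^ 2 := by
        nlinarith [sq_nonneg (‖y‖ * |φ y| / 2 - 2 * ‖gradient φ y‖), sq_abs (φ y)]
      have h3 : 2 * (gaussWeight y * (φ y * ⟪y, gradient φ y⟫)) ≤
          gaussWeight y * (2 * (|φ y| * (‖y‖ * ‖gradient φ y‖))) := by
        have := mul_le_mul_of_nonneg_left hcs hγ
        linarith
      have h4 : gaussWeight y * (2 * (|φ y| * (‖y‖ * ‖gradient φ y‖))) ≤
          gaussWeight y * ((1 / 4 : ℝ) * (‖y‖ ^ 2 * φ y ^ 2) + 4 * ‖gradient φ y‖ ^ 2) :=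
        mul_le_mul_of_nonneg_left hy2 hγ
      linarith
    have hm := integral_mono (μ := (volume : Measure E))
      (f := fun y => (2 : ℝ) * (gaussWeight y * (φ y * ⟪y, gradient φ y⟫)))
      (g := fun y => (1 / 4 : ℝ) * (‖y‖ ^ 2 * φ y ^ 2 * gaussWeight y) +
        4 * (gaussWeight y * ‖gradient φ y‖ ^ 2))
      (iY.const_mul 2) ((iX.const_mul _).add (iB.const_mul _)) hpt
    rw [integral_const_mul, integral_add (iX.const_mul _) (iB.const_mul _), integral_const_mul,
      integral_const_mul] at hm
    exact hm
  linarith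

/-- **Gaussian tails** of a test function: `∫_{|y| ≥ R} γ φ² ≤ R⁻² ∫ |y|² φ² γ`. [folklore] -/
theorem setIntegral_gaussWeight_mul_sq_le {φ : E → ℝ} (hφ : Continuous φ) (hc : HasCompactSupport φ)
    {R : ℝ} (hR : 0 < R) :
    ∫ y in {y | R ≤ ‖y‖}, gaussWeight y * φ y ^ 2 ≤
      R⁻¹ ^ 2 * ∫ y, ‖y‖ ^ 2 * φ y ^ 2 * gaussWeight y := by
  have hθc : HasCompactSupport (fun z => φ z ^ 2) := hc.comp_left (g := fun t : ℝ => t ^ 2) (by simp)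
  have iA : Integrable (fun y => gaussWeight y * φ y ^ 2) :=
    (continuous_gaussWeight.mul (hφ.pow 2)).integrable_of_hasCompactSupport hθc.mul_left
  have iX : Integrable (fun y => ‖y‖ ^ 2 * φ y ^ 2 * gaussWeight y) :=
    (((continuous_norm.pow 2).mul (hφ.pow 2)).mul continuous_gaussWeight)
      |>.integrable_of_hasCompactSupport (hθc.mul_left.mul_right)
  have hS : MeasurableSet {y : E | R ≤ ‖y‖} := measurableSet_le measurable_const measurable_norm
  calc ∫ y in {y | R ≤ ‖y‖}, gaussWeight y * φ y ^ 2
      ≤ ∫ y in {y | R ≤ ‖y‖}, R⁻¹ ^ 2 * (‖y‖ ^ 2 * φ y ^ 2 * gaussWeight y) := by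
        refine setIntegral_mono_on iA.integrableOn (iX.const_mul _).integrableOn hS fun y hy => ?_
        have hy' : R ≤ ‖y‖ := hy
        have h1 : 1 ≤ R⁻¹ ^ 2 * ‖y‖ ^ 2 := by
          rw [← mul_pow, inv_mul_eq_div, one_le_sq_iff_one_le_abs, abs_of_nonneg (by positivity)]
          rwa [le_div_iff₀ hR, one_mul]
        have h0 : 0 ≤ gaussWeight y * φ y ^ 2 := mul_nonneg (gaussWeight_pos y).le (sq_nonneg _)
        nlinarith
    _ ≤ ∫ y, R⁻¹ ^ 2 * (‖y‖ ^ 2 * φ y ^ 2 * gaussWeight y) :=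
        setIntegral_le_integral (iX.const_mul _) (Eventually.of_forall fun y => by
          have := mul_nonneg (mul_nonneg (sq_nonneg ‖y‖) (sq_nonneg (φ y))) (gaussWeight_pos y).le
          positivity)
    _ = R⁻¹ ^ 2 * ∫ y, ‖y‖ ^ 2 * φ y ^ 2 * gaussWeight y := integral_const_mul _ _

/-! ### The constant pair `(1, 0)` belongs to `V` -/

/-- Bundling a smooth compactly supported function as a test function on the whole space. [folklore] -/
def mkTest (f : E → ℝ) (hf : ContDiff ℝ ∞ f) (hc : HasCompactSupport f) : 𝓓((⊤ : Opens E), ℝ) :=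
  ⟨f, hf, hc, by simp⟩

omit [FiniteDimensional ℝ E] [MeasurableSpace E] [BorelSpace E] in
/-- Unfolding `mkTest`. [folklore] -/
@[simp] theorem coe_mkTest (f : E → ℝ) (hf : ContDiff ℝ ∞ f) (hc : HasCompactSupport f) :
    (mkTest f hf hc : E → ℝ) = f := rfl

/-- The constant function `1` in `L²(γ)`. [folklore] -/
def gaussOne : GaussL2 E := (memLp_const (1 : ℝ)).toLp (fun _ : E => (1 : ℝ))

/-- `1 ∈ L²(γ)` is a.e. the constant `1`. [folklore] -/
theorem coeFn_gaussOne : ∀ᵐ y ∂(volume : Measure E), (gaussOne : E → ℝ) y = 1 :=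
  ae_gaussMeasure_iff.1 (memLp_const (1 : ℝ)).coeFn_toLp

/-- The constant pair `(1, 0) ∈ L²(γ) × L²(γ; E)`. [folklore] -/
def gaussOnePair : GaussProd E := WithLp.toLp 2 (gaussOne, 0)

/-- First component of `(1, 0)`. [folklore] -/
@[simp] theorem gaussOnePair_fst : (gaussOnePair (E := E)).fst = gaussOne := rfl
/-- Second component of `(1, 0)`. [folklore] -/
@[simp] theorem gaussOnePair_snd : (gaussOnePair (E := E)).snd = 0 := rfl


/-- The cut-offs `χ_{n+1}` as test functions. [folklore] -/
def cutoffTest (n : ℕ) : 𝓓((⊤ : Opens E), ℝ) :=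
  mkTest (cutoff ((n : ℝ) + 1)) (contDiff_cutoff _) (hasCompactSupport_cutoff (by positivity))

omit [MeasurableSpace E] [BorelSpace E] in
/-- Unfolding `cutoffTest`. [folklore] -/
@[simp] theorem coe_cutoffTest (n : ℕ) : (cutoffTest n : E → ℝ) = cutoff ((n : ℝ) + 1) := rfl

/-- **`(1, 0) ∈ V`**: the graph pairs of the cut-offs `χ_n` converge to `(1, 0)` in
`L²(γ) × L²(γ; E)` (`χ_n → 1` dominatedly, `‖∇χ_n‖ ≤ C/n`). [folklore] -/
theorem tendsto_testPair_cutoffTest :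
    Tendsto (fun n => testPair (cutoffTest (E := E) n)) atTop (𝓝 gaussOnePair) := by
  obtain ⟨C, hC0, hC⟩ := exists_norm_fderiv_cutoff_le (E := E)
  -- the two squared component norms
  have hfst : ∀ n : ℕ, ‖((testPair (cutoffTest (E := E) n)).fst : GaussL2 E) - (gaussOne : GaussL2 E)‖ ^ 2 =
      ∫ y : E, gaussWeight y * (cutoff ((n : ℝ) + 1) y - 1) ^ 2 := by
    intro n
    rw [norm_sq_gaussL2]
    refine integral_congr_ae ?_
    filter_upwards [ae_gaussMeasure_iff.1 (Lp.coeFn_sub (((testPair (cutoffTest (E := E) n)).fst : GaussL2 E)) (gaussOne : GaussL2 E)),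
      ae_gaussMeasure_iff.1 (coeFn_testPair_fst (cutoffTest (E := E) n)), coeFn_gaussOne] with y h1 h2 h3
    rw [h1, Pi.sub_apply, h2, h3, coe_cutoffTest]
  have hsnd : ∀ n : ℕ, ‖((testPair (cutoffTest (E := E) n)).snd : GaussL2Vec E)‖ ^ 2 =
      ∫ y : E, gaussWeight y * ‖gradient (cutoff ((n : ℝ) + 1)) y‖ ^ 2 := by
    intro n
    rw [norm_sq_gaussL2Vec]
    refine integral_congr_ae ?_
    filter_upwards [ae_gaussMeasure_iff.1 (coeFn_testPair_snd (cutoffTest (E := E) n))] with y h1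
    rw [h1, coe_cutoffTest]
  -- first component: dominated convergence
  have h1 : Tendsto (fun n : ℕ => ∫ y : E, gaussWeight y * (cutoff ((n : ℝ) + 1) y - 1) ^ 2) atTop (𝓝 0) := by
    have := tendsto_integral_of_dominated_convergence (μ := (volume : Measure E))
      (F := fun (n : ℕ) (y : E) => gaussWeight y * (cutoff ((n : ℝ) + 1) y - 1) ^ 2)
      (f := fun _ => 0) (bound := gaussWeight) (fun n => ?_) integrable_gaussWeight (fun n => ?_) ?_
    · simpa using this
    · exact (continuous_gaussWeight.mul (((contDiff_cutoff (n := 0) _).continuous.sub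
        continuous_const).pow 2)).aestronglyMeasurable
    · refine Eventually.of_forall fun y => ?_
      rw [Real.norm_of_nonneg (mul_nonneg (gaussWeight_pos y).le (sq_nonneg _))]
      have h0 := cutoff_nonneg ((n : ℝ) + 1) y
      have h1 := cutoff_le_one ((n : ℝ) + 1) y
      have : (cutoff ((n : ℝ) + 1) y - 1) ^ 2 ≤ 1 := by nlinarith
      calc gaussWeight y * (cutoff ((n : ℝ) + 1) y - 1) ^ 2 ≤ gaussWeight y * 1 :=
            mul_le_mul_of_nonneg_left this (gaussWeight_pos y).le
        _ = gaussWeight y := mul_one _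
    · refine Eventually.of_forall fun y => ?_
      have ht := ((tendsto_cutoff_natCast_add_one y).sub_const 1).pow 2
      simpa using ht.const_mul (gaussWeight y)
  -- second component: `≤ (C/(n+1))² ∫ γ`
  have h2 : Tendsto (fun n : ℕ => ∫ y : E, gaussWeight y * ‖gradient (cutoff ((n : ℝ) + 1)) y‖ ^ 2) atTop (𝓝 0) := by
    have hup : ∀ n : ℕ, ∫ y : E, gaussWeight y * ‖gradient (cutoff ((n : ℝ) + 1)) y‖ ^ 2 ≤
        (C / ((n : ℝ) + 1)) ^ 2 * ∫ y : E, gaussWeight y := by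
      intro n
      rw [← integral_const_mul]
      refine integral_mono_of_nonneg (Eventually.of_forall fun y =>
        mul_nonneg (gaussWeight_pos y).le (sq_nonneg _)) (integrable_gaussWeight.const_mul _)
        (Eventually.of_forall fun y => ?_)
      have hn : (0 : ℝ) < n + 1 := by positivity
      have hb : ‖gradient (cutoff ((n : ℝ) + 1)) y‖ ≤ C / ((n : ℝ) + 1) := by
        rw [norm_gradient_eq_norm_fderiv]; exact hC _ hn y
      have : ‖gradient (cutoff ((n : ℝ) + 1)) y‖ ^ 2 ≤ (C / ((n : ℝ) + 1)) ^ 2 :=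
        pow_le_pow_left₀ (norm_nonneg _) hb 2
      calc gaussWeight y * ‖gradient (cutoff ((n : ℝ) + 1)) y‖ ^ 2
          ≤ gaussWeight y * (C / ((n : ℝ) + 1)) ^ 2 := mul_le_mul_of_nonneg_left this (gaussWeight_pos y).le
        _ = (C / ((n : ℝ) + 1)) ^ 2 * gaussWeight y := mul_comm _ _
    have hlim : Tendsto (fun n : ℕ => (C / ((n : ℝ) + 1)) ^ 2 * ∫ y : E, gaussWeight y) atTop (𝓝 0) := by
      have ht : Tendsto (fun n : ℕ => C / ((n : ℝ) + 1)) atTop (𝓝 0) :=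
        tendsto_const_nhds.div_atTop (tendsto_natCast_atTop_atTop.atTop_add tendsto_const_nhds)
      simpa using (ht.pow 2).mul_const (∫ y : E, gaussWeight y)
    exact squeeze_zero (fun n => integral_nonneg fun y => mul_nonneg (gaussWeight_pos y).le (sq_nonneg _))
      hup hlim
  -- assemble
  rw [tendsto_iff_norm_sub_tendsto_zero]
  have hsq : Tendsto (fun n : ℕ => ‖testPair (cutoffTest (E := E) n) - gaussOnePair‖ ^ 2) atTop (𝓝 0) := by
    have e : ∀ n : ℕ, ‖testPair (cutoffTest (E := E) n) - gaussOnePair‖ ^ 2 =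
        (∫ y : E, gaussWeight y * (cutoff ((n : ℝ) + 1) y - 1) ^ 2) +
          ∫ y : E, gaussWeight y * ‖gradient (cutoff ((n : ℝ) + 1)) y‖ ^ 2 := by
      intro n
      rw [norm_sq_gaussProd, WithLp.sub_fst, WithLp.sub_snd, gaussOnePair_fst, gaussOnePair_snd,
        sub_zero, hfst, hsnd]
    simp_rw [e]
    simpa using h1.add h2
  have := hsq.sqrt
  simpa [Real.sqrt_sq (norm_nonneg _)] using this

/-- **The constant pair `(1, 0)` lies in `V`.** [folklore] -/
theorem gaussOnePair_mem_gaussGraph : gaussOnePair ∈ gaussGraph (E := E) :=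
  mem_gaussGraph_iff_seq.2 ⟨cutoffTest, tendsto_testPair_cutoffTest⟩

/-! ### Consequences packaged for the compactness argument -/

/-- Elements of `V` are approximable by graph pairs. [folklore] -/
theorem exists_testPair_dist_lt {x : GaussProd E} (hx : x ∈ gaussGraph (E := E)) {ε : ℝ} (hε : 0 < ε) :
    ∃ φ : 𝓓((⊤ : Opens E), ℝ), dist (testPair φ) x < ε := by
  have hx' : x ∈ closure (LinearMap.range (testPairₗ (E := E)) : Set (GaussProd E)) := by
    rw [← Submodule.topologicalClosure_coe]; exact hx
  obtain ⟨z, ⟨φ, rfl⟩, hz⟩ := Metric.mem_closure_iff.1 hx' ε hε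
  exact ⟨φ, by rwa [dist_comm]⟩

/-- `∫ γ φ² ≤ ‖(φ, ∇φ)‖²` and `∫ γ|∇φ|² ≤ ‖(φ, ∇φ)‖²`. [folklore] -/
theorem integral_sq_le_norm_sq_testPair (φ : 𝓓((⊤ : Opens E), ℝ)) :
    (∫ y, gaussWeight y * (φ : E → ℝ) y ^ 2) ≤ ‖testPair φ‖ ^ 2 ∧
      (∫ y, gaussWeight y * ‖gradient (φ : E → ℝ) y‖ ^ 2) ≤ ‖testPair φ‖ ^ 2 := by
  rw [norm_sq_testPair]
  have hA : 0 ≤ ∫ y, gaussWeight y * (φ : E → ℝ) y ^ 2 :=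
    integral_nonneg fun y => mul_nonneg (gaussWeight_pos y).le (sq_nonneg _)
  have hB : 0 ≤ ∫ y, gaussWeight y * ‖gradient (φ : E → ℝ) y‖ ^ 2 :=
    integral_nonneg fun y => mul_nonneg (gaussWeight_pos y).le (sq_nonneg _)
  exact ⟨by linarith, by linarith⟩

/-- **Hardy in graph norm**: `∫ |y|² φ² γ ≤ (4d + 16) ‖(φ, ∇φ)‖²`. [folklore] -/
theorem integral_norm_sq_mul_sq_mul_gaussWeight_le_norm_sq (φ : 𝓓((⊤ : Opens E), ℝ)) :
    ∫ y, ‖y‖ ^ 2 * (φ : E → ℝ) y ^ 2 * gaussWeight y ≤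
      (4 * Module.finrank ℝ E + 16) * ‖testPair φ‖ ^ 2 := by
  have h := integral_norm_sq_mul_sq_mul_gaussWeight_le φ.contDiff φ.hasCompactSupport
  obtain ⟨h1, h2⟩ := integral_sq_le_norm_sq_testPair φ
  have hd : (0 : ℝ) ≤ 4 * Module.finrank ℝ E := by positivity
  nlinarith

/-- **Uniform Gaussian tails in graph norm**: `∫_{|y| ≥ R} γ φ² ≤ R⁻² (4d + 16) ‖(φ, ∇φ)‖²`. [folklore] -/
theorem setIntegral_gaussWeight_mul_sq_le_norm_sq (φ : 𝓓((⊤ : Opens E), ℝ)) {R : ℝ} (hR : 0 < R) :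
    ∫ y in {y : E | R ≤ ‖y‖}, gaussWeight y * (φ : E → ℝ) y ^ 2 ≤
      R⁻¹ ^ 2 * ((4 * Module.finrank ℝ E + 16) * ‖testPair φ‖ ^ 2) := by
  refine (setIntegral_gaussWeight_mul_sq_le φ.continuous φ.hasCompactSupport hR).trans ?_
  exact mul_le_mul_of_nonneg_left (integral_norm_sq_mul_sq_mul_gaussWeight_le_norm_sq φ) (by positivity)

end PineauVicol2026

end Literature.Analysis.FluidPDE
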